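import Literature.NumberTheory.IwasawaTheory.ClassNumberPExpZeroCyclotomicSubfield
import HarnessLib

set_option autoImplicit false

/-!
# `h(ℚ(ζ₄)) = 1` and `e_n = 0` up EVERY `ℤ₂`-tower of a fourth cyclotomic field (Iwasawa 1956 at `ℚ(√−1)`; fact-free)

Topic `NumberTheory/IwasawaTheory` (namespace = path). THEOREM-ONLY file (no definition, no named fact, no instance, no `sorry`),
written by the prover seat `cruxlead-stmt-BirchSwinnertonDyer-19573-w2` GEN 6 (cell `bsd-2adic`; `--supports` stmt-BirchSwinnertonDyer-19573,
crux 202 `OrdKatoHalfAtTwoIso`; closes nothing). The `p = 2` companion of §5 of `ClassNumberPExpZeroCyclotomicSubfield.lean` (there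
`p = 3, 5` via Mathlib's `three_pid` / `five_pid`):

* `four_pid` — if `IsCyclotomicExtension {2 ^ 2} ℚ K` then `𝓞 K` is a principal ideal domain: Minkowski's bound
  (`RingOfIntegers.isPrincipalIdealRing_of_abs_discr_lt`) with `|d_K| = 4` (`IsCyclotomicExtension.Rat.discr_prime_pow`), `[K : ℚ] = 2`,
  one complex place — `4 < π²`. (Mathlib proves `3` and `5`; `ℤ[i]` is Euclidean in Mathlib as `GaussianInt`, but the cyclotomic spelling is
  the one the Iwasawa-1956 doors consume.)
* `classNumber_eq_one_of_isCyclotomicExtension_four`; `classNumberPExp_eq_zero_of_isCyclotomicExtension_four` — `e_n(κ) = 0` for EVERY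
  `ℤ₂`-extension `κ` of a fourth cyclotomic field and every `n` (the DISCHARGED Iwasawa-1956 fact, one prime above `2`:
  `classNumberPExp_eq_zero_of_isCyclotomicExtension_prime_pow 2 1`); `classicalMuVanishes_of_isCyclotomicExtension_four` (growth form).

Consumer (cell bsd-2adic, crux 202 / K4): with `Lim2017.thm35_at_two_upstairs_…_holds` (p716773), Coates–Sujatha's statement (A) at `p = 2`
becomes UNCONDITIONAL for every elliptic curve over `ℚ` with FULL RATIONAL `2`-TORSION (`ℚ(E[2], √−1) = ℚ(ζ₄)`), Summits side.

References: [Washington1997] Thm. 11.1 (the cyclotomic fields of class number one; `ℚ(ζ₄) = ℚ(i)`), Prop. 13.22, Thm. 10.4;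
[Greenberg2001IwasawaPastPresent] Prop. 2.1 p. 339 and p. 342; [NeukirchANT1999] Ch. I §10 Lemma 10.1 (the prime above `p` in `ℚ(ζ_{pⁿ})`).
-/

noncomputable section

open scoped NumberField

open NumberField

namespace Literature.NumberTheory.IwasawaTheory

open Literature.NumberTheory.EllipticCurves

/-- **`𝓞 K` is a PID for every fourth cyclotomic extension `K` of `ℚ`** (`K ≅ ℚ(ζ₄) = ℚ(√−1)`, `h = 1`): Minkowski's bound —
`|d_K| = 4`, `[K : ℚ] = 2`, `r₂ = 1`, and `4 < (2 · (π/4) · (2²/2!))² = π²`. The `n = 4` twin of Mathlib's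
`IsCyclotomicExtension.Rat.three_pid` / `five_pid` (same proof). [cite: Washington1997, Thm. 11.1 (ℚ(ζ_n) has class number one for n = 4)] -/
theorem four_pid (K : Type*) [Field K] [NumberField K] [IsCyclotomicExtension {2 ^ 2} ℚ K] :
    IsPrincipalIdealRing (𝓞 K) := by
  haveI : Fact (Nat.Prime 2) := ⟨Nat.prime_two⟩
  apply RingOfIntegers.isPrincipalIdealRing_of_abs_discr_lt
  rw [IsCyclotomicExtension.Rat.discr_prime_pow (K := K) (p := 2) (k := 2), IsCyclotomicExtension.finrank (n := 2 ^ 2) K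
    (Polynomial.cyclotomic.irreducible_rat (by norm_num)), IsCyclotomicExtension.Rat.nrComplexPlaces_eq_totient_div_two (2 ^ 2) K]
  have htot : Nat.totient (2 ^ 2) = 2 := by decide
  rw [htot]
  norm_num
  have hπ : (3 : ℝ) < Real.pi := Real.pi_gt_three
  nlinarith [hπ, Real.pi_pos]

/-- `h(K) = 1` for every fourth cyclotomic extension `K` of `ℚ`. [cite: Washington1997, Thm. 11.1] -/
theorem classNumber_eq_one_of_isCyclotomicExtension_four (K : Type*) [Field K] [NumberField K]
    [IsCyclotomicExtension {2 ^ 2} ℚ K] : NumberField.classNumber K = 1 :=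
  NumberField.classNumber_eq_one_iff.mpr (four_pid K)

/-- **`e_n(κ) = 0` for EVERY `ℤ₂`-extension `κ` of a fourth cyclotomic field `K` and every `n`** (Iwasawa 1956 / Greenberg Prop. 2.1:
`2 ∤ h(K) = 1` and exactly one prime of `K` above `2` — the DISCHARGED tree fact, through
`classNumberPExp_eq_zero_of_isCyclotomicExtension_prime_pow 2 1`). In particular `2 ∤ h(ℚ(ζ_{2^{n+2}}))` for all `n` (Weber).
[cite: Greenberg2001IwasawaPastPresent, Prop. 2.1 p. 339 and p. 342] [cite: Washington1997, Prop. 13.22 and Thm. 10.4] -/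
theorem classNumberPExp_eq_zero_of_isCyclotomicExtension_four [Fact (2 : ℕ).Prime] (K : Type) [Field K] [NumberField K]
    [h : IsCyclotomicExtension {2 ^ 2} ℚ K] (κ : ZpExtension K 2) (n : ℕ) : classNumberPExp κ n = 0 := by
  haveI : IsCyclotomicExtension {2 ^ (1 + 1)} ℚ K := h
  exact classNumberPExp_eq_zero_of_isCyclotomicExtension_prime_pow 2 1 K
    (by rw [classNumber_eq_one_of_isCyclotomicExtension_four K]; decide) κ n

/-- **Growth form: `ClassicalMuVanishes κ` (indeed `λ = μ = ν = 0`) for EVERY `ℤ₂`-extension `κ` of a fourth cyclotomic field** — in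
particular for the cyclotomic `ℤ₂`-extension `ℚ(μ_{2^∞})/ℚ(√−1)`. Fact-free. [cite: Greenberg2001IwasawaPastPresent, Prop. 2.1 p. 339 and p. 342] -/
theorem classicalMuVanishes_of_isCyclotomicExtension_four [Fact (2 : ℕ).Prime] (K : Type) [Field K] [NumberField K]
    [IsCyclotomicExtension {2 ^ 2} ℚ K] (κ : ZpExtension K 2) : ClassicalMuVanishes κ :=
  classicalMuVanishes_of_eventually_const κ (c := 0) (n₀ := 0) fun n _ =>
    classNumberPExp_eq_zero_of_isCyclotomicExtension_four K κ n

end Literature.NumberTheory.IwasawaTheory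

end
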